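import Summits.HodgeConjecture.CorCM.IrreducibleOddWeightsShadowModulesOneSided
import Summits.HodgeConjecture.CorCM.IrreducibleOddWeightsShadowModulesCMFields
import HarnessLib

/-!
# Shadow modules, VII (CM fields): ONE-SIDED DEFECT QUANTISATION — a CM field containing an (IRR) pivot `T₀ ⊇` trace,
# against an ARBITRARY CM partner: `dim Hg(A₀)+dim Hg(A₁)−dim Hg(A₀×A₁) ∈ {0, [T₀:ℚ]/2}` for all types;
# the non-zero case is ABSORPTION of the shadow module by the partner

COR-CM (cell `pub-hodgecm2`, binder seat `b16` gen 69, count-neutral claim ROW SPACES OVER THE COMMUTANT, file Q7b — CM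
fields; theorems only, no definition, no named fact, no `sorry`).  NEW as stated, hence under `Summits/`.  HONEST
FRAMING: Galois theory of CM fields inside `ℂ` and file Q7's linear algebra, with consequences for `dim MT(A₀ × A₁)`
(Kubota–Dodson rank = `dim MT`); nothing is claimed about the algebraicity of Hodge classes beyond the tree's theorems;
`HC_CM` is neither used nor asserted.  Gen 51/55's Goursat dichotomy for an (IRR) FIELD `K_{i₀}` (`PairFlipTransportDichotomy`,
`IrreducibleOddWeightsPartners`) is the case `T₀ = K_{i₀}`; the pivot form covers every CM field CONTAINING an (IRR) CM
subfield that contains the trace of the partner (e.g. all disjoint inflations `T₀F ⊇ T₀`, gen 68).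

* **`cmTypeRank_add_cmTypeRank_eq_or_of_irreducible_left`** — `T₀ ⊆ K_{i₀}` a CM subfield with (IRR) odd weights
  containing the trace of `K_{i₁}` (TR); `K_{i₁}` and both types ARBITRARY ⟹ `cmTypeRank Φ₀ + cmTypeRank Φ₁ = cmFamilyRank Φ + 1`
  (`Hg(A₀ × A₁) = Hg(A₀) × Hg(A₁)`) or `= cmFamilyRank Φ + 1 + [T₀:ℚ]/2`.
* **`cmTypeRank_add_cmTypeRank_ne_iff_le_of_irreducible_left`** — for a type `Φ₀` with non-zero shadow on `T₀` (automatic at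
  odd index `[K_{i₀}:T₀]`, gen 68 P2) the pair interacts IFF `S(w₀) ≤ MC₁`: every shadow coefficient `g ↦ w₀(g∘y)` of
  slot `i₀` is a rational combination of the matrix coefficients `g ↦ u₁(g∘x)` of the partner — the character module of
  the pivot torus is ABSORBED by `MT(A₁)`.

## References

* [Gordon1999HodgeAVSurvey] B. B. Gordon, *A survey of the Hodge conjecture for abelian varieties*, §3 Theorem (Imai,
  Murty) with proof, 7.5–7.7, 9.4.3.
* [Serre1977] J.-P. Serre, *Linear Representations of Finite Groups*, GTM 42, §2.2, §2.6.
* [Shimura1998] G. Shimura, *Abelian Varieties with Complex Multiplication and Modular Functions*, §8.1, §18.1.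
-/

set_option autoImplicit false

noncomputable section

open scoped BigOperators Classical

open CategoryTheory CategoryTheory.Limits NumberField Module IntermediateField

namespace Summit.HodgeConjecture.CorCM

open Literature.NumberTheory.ComplexMultiplication
open Literature.AlgebraicGeometry.Motives (AbelianVariety CMType)
open Literature.AlgebraicGeometry.Motives.AbelianVariety
open Literature.AlgebraicGeometry.HodgeTheory
open Literature.AlgebraicGeometry.ComplexMultiplication (IsCMTypeRealisation)
open Literature.AlgebraicGeometry.Pohlmann1968

variable {I : Type} [Fintype I] {K : I → Type} [∀ i, Field (K i)] [∀ i, NumberField (K i)] [∀ i, IsCMField (K i)]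
  {T₀ : Type} [Field T₀] [NumberField T₀] [IsCMField T₀]

/-- **ONE-SIDED DEFECT QUANTISATION (CM fields).**  `T₀ ⊆ K_{i₀}` a CM subfield containing the trace of `K_{i₁}` (TR)
whose odd weights `Anti(T₀)` are an IRREDUCIBLE `Aut(ℂ)`-module; the partner `K_{i₁}` and both CM types arbitrary.  Then
`cmTypeRank Φ₀ + cmTypeRank Φ₁ = cmFamilyRank Φ + 1` (`Hg(A₀ × A₁) = Hg(A₀) × Hg(A₁)`) or
`cmTypeRank Φ₀ + cmTypeRank Φ₁ = cmFamilyRank Φ + 1 + [T₀:ℚ]/2`: the defect is `0` or `[T₀:ℚ]/2`.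
[cite: Gordon1999HodgeAVSurvey, §3 Theorem, 7.5–7.7 and 9.4.3] [cite: Serre1977, §2.6] -/
theorem cmTypeRank_add_cmTypeRank_eq_or_of_irreducible_left {i₀ i₁ : I} (h01 : i₀ ≠ i₁) (hI : ∀ l, l = i₀ ∨ l = i₁)
    (Φ : ∀ i, CMType (K i)) [Algebra T₀ (K i₀)]
    (htr₀ : ∀ (a : K i₀ →+* ℂ) (k : K i₀), a k ∈ normalClosure ℚ (K i₁) ℂ → k ∈ Set.range (algebraMap T₀ (K i₀)))
    (hirr₀ : ∀ W : Submodule ℚ ((T₀ →+* ℂ) → ℚ), W ≤ antiWeights (E := T₀ →+* ℂ) (starRingAut : ℂ ≃+* ℂ) → W ≠ ⊥ →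
      (∀ (k : ℂ ≃+* ℂ) (f : (T₀ →+* ℂ) → ℚ), f ∈ W → (fun y => f (k • y)) ∈ W) →
        W = antiWeights (E := T₀ →+* ℂ) (starRingAut : ℂ ≃+* ℂ)) :
    cmTypeRank (Φ i₀) + cmTypeRank (Φ i₁) = CMAlgebra.cmFamilyRank Φ + 1 ∨
      cmTypeRank (Φ i₀) + cmTypeRank (Φ i₁) = CMAlgebra.cmFamilyRank Φ + 1 + Module.finrank ℚ T₀ / 2 := by
  haveI : ∀ i, Nonempty (K i →+* ℂ) := fun i => inferInstance
  rw [← finrank_antiWeights_ringHom_eq (T := T₀)]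
  exact IrrOdd.typeRank_add_typeRank_eq_or_eq_add_finrank_of_irreducible_left (G := ℂ ≃+* ℂ)
    (E := fun i => K i →+* ℂ) (Φ := fun i => (Φ i).1) (fun i => isCMTypeWith_conj (Φ i)) hI h01
    (fun t : K i₀ →+* ℂ => t.comp (algebraMap T₀ (K i₀))) (fun _ _ => rfl)
    (exists_stab_smul_eq_of_comp_eq_of_trace_le i₁ htr₀) comp_smul_mem_antiWeights_ringHom hirr₀
    (shadow_comp_algebraMap_mem_antiWeights (Φ i₀))

/-- **ABSORPTION CRITERION (CM fields).**  Under the same hypotheses, for a type `Φ₀` whose shadow `w₀` on `Hom(T₀,ℂ)`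
is non-zero (automatic when `[K_{i₀}:T₀]` is odd), the pair INTERACTS (`dim Hg(A₀ × A₁) < dim Hg(A₀) + dim Hg(A₁)`,
defect `[T₀:ℚ]/2`) IFF `S(w₀) ≤ MC₁`: every shadow coefficient `g ↦ w₀(g ∘ y)` is a rational combination of the partner's
matrix coefficients `g ↦ u₁(g ∘ x)`. [cite: Gordon1999HodgeAVSurvey, §3 Theorem, 7.5–7.7] [cite: Serre1977, §2.2] -/
theorem cmTypeRank_add_cmTypeRank_ne_iff_le_of_irreducible_left {i₀ i₁ : I} (h01 : i₀ ≠ i₁)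
    (hI : ∀ l, l = i₀ ∨ l = i₁) (Φ : ∀ i, CMType (K i)) [Algebra T₀ (K i₀)]
    (htr₀ : ∀ (a : K i₀ →+* ℂ) (k : K i₀), a k ∈ normalClosure ℚ (K i₁) ℂ → k ∈ Set.range (algebraMap T₀ (K i₀)))
    (hirr₀ : ∀ W : Submodule ℚ ((T₀ →+* ℂ) → ℚ), W ≤ antiWeights (E := T₀ →+* ℂ) (starRingAut : ℂ ≃+* ℂ) → W ≠ ⊥ →
      (∀ (k : ℂ ≃+* ℂ) (f : (T₀ →+* ℂ) → ℚ), f ∈ W → (fun y => f (k • y)) ∈ W) →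
        W = antiWeights (E := T₀ →+* ℂ) (starRingAut : ℂ ≃+* ℂ))
    (hw₀ : (fun y : T₀ →+* ℂ => ∑ t ∈ Finset.univ.filter (fun t : K i₀ →+* ℂ => t.comp (algebraMap T₀ (K i₀)) = y),
      antiVec (Φ i₀).1 (1 : ℂ ≃+* ℂ) t) ≠ 0) :
    cmTypeRank (Φ i₀) + cmTypeRank (Φ i₁) ≠ CMAlgebra.cmFamilyRank Φ + 1 ↔
      Submodule.span ℚ (Set.range fun y : T₀ →+* ℂ => fun g : ℂ ≃+* ℂ =>
          ∑ t ∈ Finset.univ.filter (fun t : K i₀ →+* ℂ => t.comp (algebraMap T₀ (K i₀)) = g • y),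
            antiVec (Φ i₀).1 (1 : ℂ ≃+* ℂ) t) ≤
        Submodule.span ℚ (Set.range fun x : K i₁ →+* ℂ => fun g : ℂ ≃+* ℂ => antiVec (Φ i₁).1 g x) := by
  haveI : ∀ i, Nonempty (K i →+* ℂ) := fun i => inferInstance
  exact IrrOdd.typeRank_add_typeRank_ne_iff_le_of_irreducible_left (G := ℂ ≃+* ℂ)
    (E := fun i => K i →+* ℂ) (Φ := fun i => (Φ i).1) (fun i => isCMTypeWith_conj (Φ i)) hI h01
    (fun t : K i₀ →+* ℂ => t.comp (algebraMap T₀ (K i₀))) (fun _ _ => rfl)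
    (exists_stab_smul_eq_of_comp_eq_of_trace_le i₁ htr₀) comp_smul_mem_antiWeights_ringHom hirr₀
    (shadow_comp_algebraMap_mem_antiWeights (Φ i₀)) hw₀

omit [Fintype I] [∀ i, IsCMField (K i)] [IsCMField T₀] in
/-- **ODD INDEX ⟹ the shadow is non-zero** (hypothesis `hw₀` above): for `[K_{i₀}:T₀]` odd no shadow entry vanishes
(gen 68 P2 `shadow_ne_zero_of_odd_finrank`). [cite: Gordon1999HodgeAVSurvey, 9.4.3] -/
theorem shadow_ne_zero_of_odd_index {i₀ : I} (Φ₀ : CMType (K i₀)) [Algebra T₀ (K i₀)]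
    (hodd : Odd (Module.finrank T₀ (K i₀))) :
    (fun y : T₀ →+* ℂ => ∑ t ∈ Finset.univ.filter (fun t : K i₀ →+* ℂ => t.comp (algebraMap T₀ (K i₀)) = y),
      antiVec Φ₀.1 (1 : ℂ ≃+* ℂ) t) ≠ 0 := by
  obtain ⟨y⟩ : Nonempty (T₀ →+* ℂ) := inferInstance
  intro h
  exact shadow_ne_zero_of_odd_finrank Φ₀ hodd y (congrFun h y)

end Summit.HodgeConjecture.CorCM

end
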